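import Literature.AlgebraicGeometry.Resolution.CentreBlowupAdaptedOrder
import Mathlib.Algebra.MvPolynomial.PDeriv
import HarnessLib

/-!
# [CP19] Theorem 3.6 (1) for point centres, proved in the coordinate model: an increase of `ε`
# under a point blow-up forces `p ∣ ord₀ F_{p,Z}` and kills `V` off the chart variable

Topic: `Literature/AlgebraicGeometry/Resolution`.  Cell `pub-rosobs` (resolution observatory), unit
`pub-rosobs-carver-g25`; companion of `CentreBlowupProp31.lean` / `CentreBlowupProp33.lean` (the
state-level statements [CP19] Prop. 3.1 / 3.3 proved in the model) and of `PointBlowupMohBound.lean`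
(Moh's bound for Hauser's SHADE), whose surviving-monomial lemmas are re-read here for
Cossart–Piltant's `ε`.

* V. Cossart, O. Piltant, *Resolution of singularities of arithmetical threefolds*, J. Algebra **529**
  (2019) 268–535 = arXiv:1412.0868 [CossartPiltant2019], Theorem 3.6 (p. 35): "Assume that
  `m(x) = p`, `ω(x) > 0` … Let `π : 𝒳' → 𝒳` be the blowing up along a permissible center `𝒴` … at `x`,
  `x' ∈ π⁻¹(x)` … If `ε(x') > ε(x)`, the following holds: (1) we have `i₀(m_S) = p`,
  `ε(y) = ε(x) = ω(x)`, `δ(y) ∈ ℕ`, `H_{j'} ∈ pℕ` for every `j' ∈ (J')_E` and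
  `F_{p,Z} ∈ (k(x')[U₁,…,U_n])^p[{U_j}_{j ∈ J_E ∖ {j₂,…,j_{e'₀}}}]`", where (Notation 3.2, p. 35)
  `u'_1 := u` is the chart variable `u_{j₁}` and `{j₂,…,j_{e'₀}} := {j ∈ J_E : u_j/u ∈ m_{S'}}` are the
  boundary variables of the centre whose strict transforms pass through `x'`; and the proof of
  Theorem 3.7 (p. 40): "theorem 3.6 applied to `π` gives `ε(x') ≤ ε(x) + 1`".
* T. T. Moh, *On a stability theorem for local uniformization in characteristic `p`*, Publ. RIMS
  **23** (1987) 965–973 [Moh1987] and H. Hauser, S. Perlega, Publ. RIMS **55** (2019) 835–857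
  [HauserPerlega2019PRIMS], §3 Theorem (2), (7), (9) — the same phenomena for the residual order /
  shade, formalised for the shade in `PointBlowupMohBound.lean`.

## Dictionary (the case `G = 0`, centre = the closed point)

For the POINT centre `𝒴 = {x}` one has `J = {1,…,n}`, `ε(y) = ε(x)` (the point is of the first kind,
`CentreBlowup.isFirstKind_univ`), `δ(y) = δ(x) = ord₀F_{p,Z}/p`, so "`δ(y) ∈ ℕ`" reads `p ∣ ord₀ F`;
`(J')_E = ∅`; in the chart `u = u_j` at the point `b` of the exceptional divisor (`b_j = 0`) the set
`{j₂,…,j_{e'₀}}` is `{i ∈ E : i ≠ j, b_i = 0}` (`PointBlowup.newBoundary j b E ∖ {j}`), and the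
displayed membership says: every variable `U_i`, `i ≠ j`, which is NOT an exceptional variable lost
at `b` (`i ∉ E`, or `i ∈ E` with `b_i = 0`) occurs in `F_{p,Z}` with exponents `≡ 0 (mod p)` only.
The model's numbers are those of `PointBlowupAdaptedOrder.lean` / `CentreBlowupAdaptedOrder.lean`:
`ε = ord₀ F − Σ_{i ∈ E} H_i` (`PointBlowup.epsilon E s`, `CState.epsilon`), `H_i = min` exponent of
`y_i` (`PointBlowup.bigH`), `V ≠ 0` iff `∂F_{p,Z}/∂U_t ≠ 0` for some `t ∉ E` (`PointBlowup.VNonzero`),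
the blow-up step `PointBlowup.step p j b` / `CentreBlowup.step p univ j b` (chart, translation to `b`,
deletion of `p`-th power monomials) and the transported boundary `E' = newBoundary j b E = newExc j b s`.

## What is proved (every field `K` of characteristic `p`, every finite index type `σ`)

For a point state `s = (F, r)` and a boundary `E`, `ord₀ F = o ≥ p`, chart `j`, point `b` with `b_j = 0`:

* `PointBlowup.epsilon_step_le_add_one` — `ε(E', x') ≤ ε(E, x) + 1` for CLEAN `F` ("`ε(x') ≤ ε(x)+1`",
  proof of Thm. 3.7; Moh's bound in the `ε`-reading).
* `PointBlowup.epsilon_step_le_of_not_dvd` — no increase of `ε` if `p ∤ o` (clause "`δ(y) ∈ ℕ`").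
* `PointBlowup.epsilon_step_le_of_not_dvd_apply` — no increase if some initial monomial `y^d`
  (`|d| = o`) has `p ∤ d_i` at an index `i ≠ j` with `i ∉ E` or `b_i = 0` (the displayed membership
  of (1), contrapositive, for every variable other than the chart variable).
* `PointBlowup.necessary_of_epsilonIncreases` — hence an increase of `ε` forces `p ∣ o`, all those
  exponents `≡ 0 (mod p)`, and (for clean `F`) a LOST boundary component `i ∈ E`, `b_i ≠ 0`, `i ≠ j`,
  carrying an initial exponent prime to `p`.
* `PointBlowup.exists_not_dvd_of_pderiv_initialForm_ne_zero` — in characteristic `p`,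
  `∂F_{p,Z}/∂U_t ≠ 0` exhibits an initial monomial with exponent prime to `p` at `t`; whence
  `PointBlowup.epsilon_step_le_of_pderiv_ne_zero` and `PointBlowup.eq_chart_of_epsilonIncreases`:
  **an increase of `ε` at a point blow-up kills every `V`-witness except possibly the chart variable**
  — the clause "`ε(x) = ω(x)`" of (1) for all witnesses `t ≠ j`.
* `CentreBlowup.CState.…_univ…` — the same read on the `CState`s of the centre-blow-up model at
  `S = univ` (`EpsilonIncreases p univ j b s`), and two PROVED families of instances of the atlas
  predicate `EpsilonIncreaseForcesFirstKindAt p univ j b s` ([CP19, Thm. 3.6 (1)] read at one step):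
  it holds whenever the chart variable is exceptional (`j ∈ exc`) or is not a `V`-witness
  (`∂F_{p,Z}/∂U_j = 0`).

## Scope / what is NOT proved

The published (1) constrains ALSO the chart variable `U_{j₁}` when `j₁ ∉ J_E` (it is absent from the
adjoined list): in the model, "an increase of `ε` at the point `b` of the chart `y_j`, `j ∉ E`, forces
`p ∣ d_j` for every initial monomial" — equivalently `ω(x) = ε(x)` with no proviso.  This residual
clause is NOT proved here (Moh's derivative trick loses the exponent of the chart variable, which
becomes `|d| − p` for every initial monomial); the cell's census (CENSUS-g23 R2 (d): 1,004 / 506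
point-centre increases, all with `V_x = 0`) has no exception to it.  Hypotheses of the printed theorem
not modelled: `ω(x) > 0`, condition **(E)**, an arbitrary (possibly imperfect) residue field — the
model deletes every `p`-th power MONOMIAL of the transform, which over a PERFECT field `K` is a
coordinate change `Z ↦ Z − θ` leaving no solvable vertex ([CP19] Def. 2.3–2.4: "minimal"), but not
over an imperfect one; the theorems below are statements about the model's numbers and hold for
every field `K` of characteristic `p`.
Method: the `ε`-reading of `PointBlowupMohBound.lean` — Moh's lemmas applied to the auxiliary
multiplicity record `r := (H_i)_{i ∈ E}` (`PointBlowup.bigHVec E F`), for which `y^r ∣ F` holds by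
definition and whose shade is `ε(E, x)`; after the step the new record is dominated by the new
minimum exponents on `E'`, so the new shade dominates `ε(E', x')`.
-/

open MvPolynomial Finset

open scoped BigOperators

namespace Literature.AlgebraicGeometry.Resolution

open Literature.AlgebraicGeometry.Resolution.Hauser2010
open Literature.AlgebraicGeometry.Resolution.HauserPerlega2019 (initialForm)

namespace PointBlowup

/-! ### 0. Private helpers: the auxiliary multiplicity record `H|_E` -/

section Helpers

variable {σ : Type*} {K : Type*} [Field K]

/-- evaluation of `bigHVec`. [folklore] -/
private theorem bigHVec_apply' [DecidableEq σ] (E : Finset σ) (F : MvPolynomial σ K) (i : σ) :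
    bigHVec E F i = if i ∈ E then (bigH F i).toNat else 0 := by
  unfold bigHVec
  rw [Finsupp.finsetSum_apply]
  by_cases hi : i ∈ E
  · rw [if_pos hi, Finset.sum_eq_single_of_mem i hi (fun j _ hji => by
      rw [Finsupp.single_apply, if_neg hji])]
    exact Finsupp.single_eq_same
  · rw [if_neg hi]
    exact Finset.sum_eq_zero fun j hj => by
      have hji : j ≠ i := fun h => hi (h ▸ hj)
      rw [Finsupp.single_apply, if_neg hji]

/-- `H_i ≤ d_i` for every monomial `y^d` of `F`. [folklore] -/
private theorem bigH_le' {F : MvPolynomial σ K} {d : σ →₀ ℕ} (hd : d ∈ F.support) (i : σ) :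
    bigH F i ≤ d i :=
  Finset.inf_le (f := fun d : σ →₀ ℕ => ((d i : ℕ) : ℕ∞)) hd

/-- For `F ≠ 0`, `H_i` is finite. [folklore] -/
private theorem bigH_eq_toNat' {F : MvPolynomial σ K} (hF : F ≠ 0) (i : σ) :
    bigH F i = (((bigH F i).toNat : ℕ) : ℕ∞) := by
  obtain ⟨d, -, h⟩ := Finset.exists_mem_eq_inf F.support (MvPolynomial.support_nonempty.mpr hF)
    (fun d : σ →₀ ℕ => ((d i : ℕ) : ℕ∞))
  rw [show bigH F i = ((d i : ℕ) : ℕ∞) from h]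
  rfl

/-- For `F ≠ 0`, `ord₀ F` is finite. [folklore] -/
private theorem exists_ordZero_eq' {F : MvPolynomial σ K} (hF : F ≠ 0) : ∃ o : ℕ, ordZero F = o := by
  have hne : ordZero F ≠ ⊤ := by
    unfold ordZero
    rw [Ne, MvPowerSeries.order_eq_top_iff, MvPolynomial.coe_eq_zero_iff]
    exact hF
  exact ⟨(ordZero F).toNat, (ENat.coe_toNat hne).symm⟩

/-- A finite order means a non-zero polynomial. [folklore] -/
private theorem ne_zero_of_ordZero_eq' {F : MvPolynomial σ K} {o : ℕ} (ho : ordZero F = o) : F ≠ 0 := by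
  intro h
  rw [h, ordZero_zero] at ho
  exact ENat.top_ne_coe _ ho

/-- `y^{H|_E} ∣ F` monomialwise. [folklore] -/
private theorem bigHVec_le' [DecidableEq σ] (E : Finset σ) (F : MvPolynomial σ K) :
    ∀ d ∈ F.support, bigHVec E F ≤ d := by
  intro d hd
  have hF : F ≠ 0 := MvPolynomial.ne_zero_iff.mpr ⟨d, MvPolynomial.mem_support_iff.mp hd⟩
  rw [Finsupp.le_def]
  intro i
  rw [bigHVec_apply']
  split_ifs with hi
  · have h := bigH_le' hd i
    rw [bigH_eq_toNat' hF] at h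
    exact_mod_cast h
  · exact Nat.zero_le _

/-- `Σ_{i ∈ E} H_i = |H|_E|` for `F ≠ 0`. [folklore] -/
private theorem sum_bigH_eq' [DecidableEq σ] {F : MvPolynomial σ K} (hF : F ≠ 0) (E : Finset σ) :
    ∑ j ∈ E, bigH F j = (((bigHVec E F).degree : ℕ) : ℕ∞) := by
  unfold bigHVec
  rw [map_sum, Nat.cast_sum]
  exact Finset.sum_congr rfl fun j _ => by
    rw [Finsupp.degree_single]
    exact bigH_eq_toNat' hF j

/-- `ε(E, x)` is the shade of the auxiliary state `(F, H|_E)`. [folklore] -/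
private theorem epsilon_eq_shade' [DecidableEq σ] (E : Finset σ) (s : State σ K) (hF : s.F ≠ 0) :
    epsilon E s = (⟨s.F, bigHVec E s.F⟩ : State σ K).shade := by
  show ordZero s.F - ∑ j ∈ E, bigH s.F j = ordZero s.F - (((bigHVec E s.F).degree : ℕ) : ℕ∞)
  rw [sum_bigH_eq' hF]

/-- After the step, the new multiplicity record of the auxiliary state is dominated by the new
minimum exponents on the new boundary, so its shade dominates `ε(E', x')`. [folklore] -/
private theorem epsilon_step_le_shade_step' [Fintype σ] [DecidableEq σ] [DecidableEq K] (q : ℕ)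
    (j : σ) (b : σ → K) (hbj : b j = 0) (s : State σ K) (E : Finset σ) {o : ℕ}
    (ho : ordZero s.F = o) :
    epsilon (newBoundary j b E) (step q j b s) ≤ (step q j b ⟨s.F, bigHVec E s.F⟩).shade := by
  set t : State σ K := ⟨s.F, bigHVec E s.F⟩ with ht
  have hF' : (step q j b t).F = (step q j b s).F := rfl
  have hr : ∀ d ∈ t.F.support, t.r ≤ d := bigHVec_le' E s.F
  have hρ : ∀ e ∈ (step q j b t).F.support, (step q j b t).r ≤ e :=
    newMult_le_of_mem_support_step q j b hbj t ho hr
  have hρeq : (step q j b t).r = (t.r.update j (o - q)).filter (fun i => b i = 0) :=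
    newMult_eq q j b hbj t ho
  have hsub : ∀ i, (step q j b t).r i ≠ 0 → i ∈ newBoundary j b E := by
    intro i hi
    rw [hρeq, Finsupp.filter_apply] at hi
    unfold newBoundary
    rw [mem_insert, mem_filter]
    by_cases hij : i = j
    · exact Or.inl hij
    · right
      split_ifs at hi with hb
      · rw [Finsupp.update_apply, if_neg hij] at hi
        have hiE : i ∈ E := by
          by_contra hiE
          apply hi
          show bigHVec E s.F i = 0
          rw [bigHVec_apply', if_neg hiE]
        exact ⟨hiE, hij, hb⟩
      · exact absurd rfl hi
  have h1 : (((step q j b t).r.degree : ℕ) : ℕ∞) ≤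
      ∑ i ∈ newBoundary j b E, bigH (step q j b s).F i :=
    calc (((step q j b t).r.degree : ℕ) : ℕ∞)
        = ∑ i ∈ (step q j b t).r.support, (((step q j b t).r i : ℕ) : ℕ∞) := by
          rw [Finsupp.degree_apply, Nat.cast_sum]
      _ ≤ ∑ i ∈ newBoundary j b E, (((step q j b t).r i : ℕ) : ℕ∞) :=
          Finset.sum_le_sum_of_subset_of_nonneg
            (fun i hi => hsub i (Finsupp.mem_support_iff.mp hi)) (fun _ _ _ => zero_le)
      _ ≤ ∑ i ∈ newBoundary j b E, bigH (step q j b s).F i :=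
          Finset.sum_le_sum fun i _ =>
            Finset.le_inf fun e he => by
              exact_mod_cast Finsupp.le_def.mp (hρ e (hF' ▸ he)) i
  show ordZero (step q j b s).F - ∑ i ∈ newBoundary j b E, bigH (step q j b s).F i ≤
    ordZero (step q j b t).F - (((step q j b t).r.degree : ℕ) : ℕ∞)
  rw [hF']
  exact tsub_le_tsub_left h1 _

end Helpers

/-! ### 1. Point level: `ε` under one point blow-up -/

section Main

variable {σ : Type*} {K : Type*} [Field K] [Fintype σ] [DecidableEq σ] [DecidableEq K]
variable (p : ℕ) [hp : Fact p.Prime] [CharP K p]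

/-- **`ε(x') ≤ ε(x) + 1` under a point blow-up** ("theorem 3.6 applied to `π` gives
`ε(x') ≤ ε(x)+1`", [CP19] proof of Thm. 3.7, p. 40; Moh's one-blow-up bound / Hauser–Perlega (9) in
the `ε`-reading): for a clean residual polynomial `F` of order `o ≥ p`, any boundary `E`, any chart
`y_j` and any point `b` of the exceptional divisor (`b_j = 0`), with `E' = newBoundary j b E`.
[cite: CossartPiltant2019, Thm. 3.6 and proof of Thm. 3.7 (p. 40)] [cite: Moh1987, Stability Theorem]
[cite: HauserPerlega2019PRIMS, §3 Theorem (9)] -/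
theorem epsilon_step_le_add_one (j : σ) (b : σ → K) (hbj : b j = 0) (s : State σ K) (E : Finset σ)
    (hclean : deletePthPowers p s.F = s.F) {o : ℕ} (ho : ordZero s.F = o) (hpo : p ≤ o) :
    epsilon (newBoundary j b E) (step p j b s) ≤ epsilon E s + 1 := by
  have hF : s.F ≠ 0 := ne_zero_of_ordZero_eq' ho
  have hM := mohBound_one p j b hbj ⟨s.F, bigHVec E s.F⟩ hclean
    (by show (p : ℕ∞) ≤ ordZero s.F; rw [ho]; exact_mod_cast hpo) (bigHVec_le' E s.F)
  unfold MohBound at hM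
  rw [pow_one, Nat.sub_self, pow_zero, Nat.cast_one] at hM
  rw [epsilon_eq_shade' E s hF]
  exact le_trans (epsilon_step_le_shade_step' p j b hbj s E ho) hM

omit hp [CharP K p] in
/-- **No increase of `ε` when `p ∤ ord₀ F`** — [CP19, Thm. 3.6 (1)] for the point centre: "if
`ε(x') > ε(x)` … `δ(y) ∈ ℕ`", `δ(y) = δ(x) = ord₀F_{p,Z}/p`, contrapositive (Hauser–Perlega (2) in
the `ε`-reading). [cite: CossartPiltant2019, Thm. 3.6 (1) (p. 35)]
[cite: HauserPerlega2019PRIMS, §3 Theorem (2)] -/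
theorem epsilon_step_le_of_not_dvd (j : σ) (b : σ → K) (hbj : b j = 0) (s : State σ K)
    (E : Finset σ) {o : ℕ} (ho : ordZero s.F = o) (hpo : p ≤ o) (hndvd : ¬ p ∣ o) :
    epsilon (newBoundary j b E) (step p j b s) ≤ epsilon E s := by
  have hF : s.F ≠ 0 := ne_zero_of_ordZero_eq' ho
  have h := shade_step_le_of_not_dvd p j b hbj ⟨s.F, bigHVec E s.F⟩ ho hpo (bigHVec_le' E s.F) hndvd
  rw [epsilon_eq_shade' E s hF]
  exact le_trans (epsilon_step_le_shade_step' p j b hbj s E ho) h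

/-- **No increase of `ε` when an initial monomial has an exponent prime to `p` at a variable
`i ≠ j` which is non-exceptional or passes through `x'`** — [CP19, Thm. 3.6 (1)] for the point
centre: "if `ε(x') > ε(x)` … `F_{p,Z} ∈ (k(x')[U₁,…,U_n])^p[{U_j}_{j ∈ J_E ∖ {j₂,…,j_{e'₀}}}]`",
contrapositive, for every variable other than the chart variable `u = u_{j₁}` (Hauser–Perlega (7)
in the `ε`-reading). [cite: CossartPiltant2019, Thm. 3.6 (1) (p. 35)]
[cite: HauserPerlega2019PRIMS, §3 Theorem (7)] -/
theorem epsilon_step_le_of_not_dvd_apply (j : σ) (b : σ → K) (hbj : b j = 0) (s : State σ K)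
    (E : Finset σ) {o : ℕ} (ho : ordZero s.F = o) (hpo : p ≤ o) {i₀ : σ} (hi₀ : i₀ ≠ j)
    (hfix : i₀ ∉ E ∨ b i₀ = 0) {d₀ : σ →₀ ℕ} (hd₀ : d₀ ∈ s.F.support) (hd₀deg : d₀.degree = o)
    (hd₀i : ¬ p ∣ d₀ i₀) :
    epsilon (newBoundary j b E) (step p j b s) ≤ epsilon E s := by
  have hF : s.F ≠ 0 := ne_zero_of_ordZero_eq' ho
  have hfix' : b i₀ = 0 ∨ (⟨s.F, bigHVec E s.F⟩ : State σ K).r i₀ = 0 := by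
    rcases hfix with hiE | hb
    · right
      show bigHVec E s.F i₀ = 0
      rw [bigHVec_apply', if_neg hiE]
    · exact Or.inl hb
  have h := shade_step_le_of_not_dvd_apply p j b hbj ⟨s.F, bigHVec E s.F⟩ ho hpo (bigHVec_le' E s.F)
    hi₀ hfix' hd₀ hd₀deg hd₀i
  rw [epsilon_eq_shade' E s hF]
  exact le_trans (epsilon_step_le_shade_step' p j b hbj s E ho) h

/-- **Necessary conditions for an increase of `ε` under a point blow-up** — [CP19, Thm. 3.6 (1)]
for the point centre, clauses "`δ(y) ∈ ℕ`" (`p ∣ ord₀ F`) and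
"`F_{p,Z} ∈ (k(x')[U])^p[{U_j}_{j ∈ J_E ∖ {j₂,…,j_{e'₀}}}]`" for every variable other than the chart
variable, together with its consequence for clean `F` (Hauser–Perlega's "lost component"): some
exceptional variable `i ∈ E`, `i ≠ j`, NOT passing through `x'` (`b_i ≠ 0`) carries an initial
exponent prime to `p`. [cite: CossartPiltant2019, Thm. 3.6 (1) (p. 35)]
[cite: HauserPerlega2019PRIMS, §3 Theorem (2), (7) and Comment (d)] -/
theorem necessary_of_epsilonIncreases (j : σ) (b : σ → K) (hbj : b j = 0) (s : State σ K)
    (E : Finset σ) (hclean : deletePthPowers p s.F = s.F) {o : ℕ} (ho : ordZero s.F = o)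
    (hpo : p ≤ o) (hinc : epsilon E s < epsilon (newBoundary j b E) (step p j b s)) :
    p ∣ o ∧
    (∀ i, i ≠ j → (i ∉ E ∨ b i = 0) → ∀ d ∈ s.F.support, d.degree = o → p ∣ d i) ∧
    (∃ i, i ≠ j ∧ b i ≠ 0 ∧ i ∈ E ∧ ∃ d ∈ s.F.support, d.degree = o ∧ ¬ p ∣ d i) := by
  have hF : s.F ≠ 0 := ne_zero_of_ordZero_eq' ho
  have hinc' : ShadeIncreases p j b (⟨s.F, bigHVec E s.F⟩ : State σ K) := by
    unfold ShadeIncreases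
    rw [← epsilon_eq_shade' E s hF]
    exact lt_of_lt_of_le hinc (epsilon_step_le_shade_step' p j b hbj s E ho)
  obtain ⟨h1, h2, i, hij, hbi, hri, d, hd, hdeg, hndvd⟩ :=
    necessary_of_shadeIncreases p j b hbj ⟨s.F, bigHVec E s.F⟩ hclean ho hpo (bigHVec_le' E s.F) hinc'
  refine ⟨h1, fun i' hij' hfix d' hd' hdeg' => h2 i' hij' ?_ d' hd' hdeg', i, hij, hbi, ?_, d, hd,
    hdeg, hndvd⟩
  · rcases hfix with hiE | hb
    · right
      show bigHVec E s.F i' = 0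
      rw [bigHVec_apply', if_neg hiE]
    · exact Or.inl hb
  · by_contra hiE
    apply hri
    show bigHVec E s.F i = 0
    rw [bigHVec_apply', if_neg hiE]

omit [Fintype σ] [DecidableEq σ] [DecidableEq K] hp in
/-- **`V`-witnesses are exponents prime to `p`.** In characteristic `p`, `∂F_{p,Z}/∂U_t ≠ 0`
exhibits a monomial `y^d` of the initial form (`|d| = ord₀ F`) with `p ∤ d_t` ("`V(F,E,m_S) = 0` if
and only if `F ∈ k[U₁,…,U_e][U_{e+1}^p,…,U_n^p]`": the derivative kills exactly the exponents
`≡ 0 mod p`). [cite: CossartPiltant2019, Prop. 2.16 and Def. 2.16 (p. 21, 24)] -/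
theorem exists_not_dvd_of_pderiv_initialForm_ne_zero {F : MvPolynomial σ K} {o : ℕ}
    (ho : ordZero F = o) {t : σ} (h : pderiv t (initialForm F) ≠ 0) :
    ∃ d ∈ F.support, d.degree = o ∧ ¬ p ∣ d t := by
  obtain ⟨m, hm⟩ := MvPolynomial.ne_zero_iff.mp h
  rw [coeff_pderiv] at hm
  have hc : coeff (m + Finsupp.single t 1) (initialForm F) ≠ 0 := left_ne_zero_of_mul hm
  have hk : ((m t + 1 : ℕ) : K) ≠ 0 := by
    rw [Nat.cast_succ]
    exact right_ne_zero_of_mul hm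
  unfold HauserPerlega2019.initialForm at hc
  rw [coeff_homogeneousComponent] at hc
  by_cases hdeg : (m + Finsupp.single t 1).degree = (ordZero F).toNat
  · rw [if_pos hdeg] at hc
    refine ⟨m + Finsupp.single t 1, MvPolynomial.mem_support_iff.mpr hc, ?_, ?_⟩
    · rw [hdeg, ho]
      rfl
    · intro hdvd
      apply hk
      rw [CharP.cast_eq_zero_iff K p]
      rwa [Finsupp.add_apply, Finsupp.single_eq_same] at hdvd
  · exact absurd (by rw [if_neg hdeg]) hc

/-- **An increase of `ε` kills `V` off the chart variable** — [CP19, Thm. 3.6 (1)] for the point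
centre, clause "`ε(x) = ω(x)`" (i.e. `V(F_{p,Z},E,m_S) = 0`), for every `V`-witness variable
`t ∉ E` other than the chart variable `j`, and the boundary clause for `t ∈ E` through `x'`: if
`∂F_{p,Z}/∂U_t ≠ 0` with `t ≠ j` and (`t ∉ E` or `b_t = 0`) then `ε(x') ≤ ε(x)`.
[cite: CossartPiltant2019, Thm. 3.6 (1) (p. 35)] -/
theorem epsilon_step_le_of_pderiv_ne_zero (j : σ) (b : σ → K) (hbj : b j = 0) (s : State σ K)
    (E : Finset σ) {o : ℕ} (ho : ordZero s.F = o) (hpo : p ≤ o) {t : σ} (htj : t ≠ j)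
    (ht : t ∉ E ∨ b t = 0) (hpd : pderiv t (initialForm s.F) ≠ 0) :
    epsilon (newBoundary j b E) (step p j b s) ≤ epsilon E s := by
  obtain ⟨d, hd, hdeg, hndvd⟩ := exists_not_dvd_of_pderiv_initialForm_ne_zero p ho hpd
  exact epsilon_step_le_of_not_dvd_apply p j b hbj s E ho hpo htj ht hd hdeg hndvd

/-- **If `ε` increases at the point `b` of the chart `y_j`, the only possible `V`-witness among the
non-exceptional variables and the exceptional variables through `x'` is the chart variable itself**
— [CP19, Thm. 3.6 (1)] "`ε(y) = ε(x) = ω(x)`" for the point centre, up to the chart variable.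
[cite: CossartPiltant2019, Thm. 3.6 (1) (p. 35)] -/
theorem eq_chart_of_epsilonIncreases (j : σ) (b : σ → K) (hbj : b j = 0) (s : State σ K)
    (E : Finset σ) {o : ℕ} (ho : ordZero s.F = o) (hpo : p ≤ o)
    (hinc : epsilon E s < epsilon (newBoundary j b E) (step p j b s)) {t : σ}
    (ht : t ∉ E ∨ b t = 0) (hpd : pderiv t (initialForm s.F) ≠ 0) : t = j := by
  by_contra htj
  exact absurd (epsilon_step_le_of_pderiv_ne_zero p j b hbj s E ho hpo htj ht hpd) (not_le.mpr hinc)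

end Main

end PointBlowup

/-! ### 2. The same read on the centre-blow-up model at `S = univ` -/

namespace CentreBlowup

namespace CState

section Univ

variable {σ : Type*} {K : Type*} [Field K] [Fintype σ] [DecidableEq σ] [DecidableEq K]
variable (p : ℕ) [hp : Fact p.Prime] [CharP K p]

omit hp [CharP K p] in
/-- The blow-up of the zero polynomial has `ε = 0` (`E' ∋ j` is non-empty and `H_j(0) = ⊤`). [folklore] -/
private theorem epsilon_step_univ_of_F_eq_zero' (q : ℕ) (j : σ) (b : σ → K) (s : CState σ K)
    (hF : s.F = 0) : (step q Finset.univ j b s).epsilon = 0 := by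
  have h1 : (step q Finset.univ j b s).F = 0 := by
    show deletePthPowers q (PointBlowup.translate b (chartTransform q Finset.univ j s.F)) = 0
    unfold chartTransform PointBlowup.translate
    rw [hF, MvPolynomial.support_zero, Finset.sum_empty, map_zero, deletePthPowers_zero]
  have hj : j ∈ (step q Finset.univ j b s).exc := by
    show j ∈ newExc j b s
    exact Finset.mem_insert_self _ _
  have htop : PointBlowup.bigH (0 : MvPolynomial σ K) j = ⊤ := by
    unfold PointBlowup.bigH
    rw [MvPolynomial.support_zero, Finset.inf_empty]
  have h2 : ∑ i ∈ (step q Finset.univ j b s).exc, PointBlowup.bigH (0 : MvPolynomial σ K) i = ⊤ := by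
    refine eq_top_iff.mpr ?_
    calc (⊤ : ℕ∞) = PointBlowup.bigH (0 : MvPolynomial σ K) j := htop.symm
      _ ≤ ∑ i ∈ (step q Finset.univ j b s).exc, PointBlowup.bigH (0 : MvPolynomial σ K) i :=
          Finset.single_le_sum (f := fun i => PointBlowup.bigH (0 : MvPolynomial σ K) i)
            (fun _ _ => zero_le) hj
  rw [epsilon_eq, h1, h2]
  exact ENat.sub_top _

omit hp [CharP K p] in
/-- An increase of `ε` can only happen for `F ≠ 0`. [folklore] -/
private theorem F_ne_zero_of_epsilonIncreases' {q : ℕ} {j : σ} {b : σ → K} {s : CState σ K}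
    (hinc : EpsilonIncreases q Finset.univ j b s) : s.F ≠ 0 := by
  intro hF
  unfold EpsilonIncreases at hinc
  rw [epsilon_step_univ_of_F_eq_zero' q j b s hF] at hinc
  exact not_lt_of_ge zero_le hinc

omit [DecidableEq K] hp [CharP K p] in
/-- A permissible point centre is `p`-fold. [cite: CossartPiltant2019, Def. 3.1–3.2 (p. 31–32)] -/
private theorem le_ordZero_of_isPermissibleCentre_univ' {q : ℕ} {s : CState σ K}
    (h : IsPermissibleCentre q Finset.univ s) : (q : ℕ∞) ≤ ordZero s.F := by
  rcases h with h1 | h2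
  · have := h1.1.2
    rwa [ordAlong_univ] at this
  · have := h2.1.2
    rwa [ordAlong_univ] at this

/-- **`ε(x') ≤ ε(x) + 1` under the blow-up of the closed point** (`S = univ`), for a clean `p`-fold
state. [cite: CossartPiltant2019, Thm. 3.6 and proof of Thm. 3.7 (p. 40)]
[cite: Moh1987, Stability Theorem] [cite: HauserPerlega2019PRIMS, §3 Theorem (9)] -/
theorem epsilon_step_univ_le_add_one (j : σ) (b : σ → K) (hbj : b j = 0) (s : CState σ K)
    (hclean : deletePthPowers p s.F = s.F) (hF : s.F ≠ 0) (hord : (p : ℕ∞) ≤ ordZero s.F) :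
    (step p Finset.univ j b s).epsilon ≤ s.epsilon + 1 := by
  obtain ⟨o, ho⟩ := PointBlowup.exists_ordZero_eq' hF
  have hpo : p ≤ o := by rw [ho] at hord; exact_mod_cast hord
  rw [epsilon_step_univ]
  exact PointBlowup.epsilon_step_le_add_one p j b hbj s.toState s.exc hclean ho hpo

omit hp [CharP K p] in
/-- **`ε` does not increase under the blow-up of the closed point when `p ∤ ord₀ F_{p,Z}`**
([CP19, Thm. 3.6 (1)] "`δ(y) ∈ ℕ`" for `𝒴 = {x}`). [cite: CossartPiltant2019, Thm. 3.6 (1) (p. 35)] -/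
theorem not_epsilonIncreases_univ_of_not_dvd (j : σ) (b : σ → K) (hbj : b j = 0) (s : CState σ K)
    {o : ℕ} (ho : ordZero s.F = o) (hpo : p ≤ o) (hndvd : ¬ p ∣ o) :
    ¬ EpsilonIncreases p Finset.univ j b s := by
  unfold EpsilonIncreases
  rw [not_lt, epsilon_step_univ]
  exact PointBlowup.epsilon_step_le_of_not_dvd p j b hbj s.toState s.exc ho hpo hndvd

/-- **`ε` does not increase under the blow-up of the closed point when `V` has a witness other than
the chart variable** (or an exceptional derivative witness through `x'`): `∂F_{p,Z}/∂U_t ≠ 0`, `t ≠ j`,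
`t ∉ exc` or `b_t = 0` ([CP19, Thm. 3.6 (1)] "`ε(x) = ω(x)`", "`F_{p,Z} ∈ …`" for `𝒴 = {x}`, up to the
chart variable). [cite: CossartPiltant2019, Thm. 3.6 (1) (p. 35)] -/
theorem not_epsilonIncreases_univ_of_pderiv_ne_zero (j : σ) (b : σ → K) (hbj : b j = 0)
    (s : CState σ K) (hord : (p : ℕ∞) ≤ ordZero s.F) {t : σ} (htj : t ≠ j)
    (ht : t ∉ s.exc ∨ b t = 0) (hpd : pderiv t (initialForm s.F) ≠ 0) :
    ¬ EpsilonIncreases p Finset.univ j b s := by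
  intro hinc
  have hF : s.F ≠ 0 := F_ne_zero_of_epsilonIncreases' hinc
  obtain ⟨o, ho⟩ := PointBlowup.exists_ordZero_eq' hF
  have hpo : p ≤ o := by rw [ho] at hord; exact_mod_cast hord
  unfold EpsilonIncreases at hinc
  rw [epsilon_step_univ] at hinc
  exact absurd (PointBlowup.epsilon_step_le_of_pderiv_ne_zero p j b hbj s.toState s.exc ho hpo htj ht
    hpd) (not_le.mpr hinc)

/-- **If `ε` increases under the blow-up of the closed point, every `V`-witness `t ∉ exc` (and every
exceptional derivative witness through `x'`) is the chart variable.**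
[cite: CossartPiltant2019, Thm. 3.6 (1) (p. 35)] -/
theorem eq_chart_of_epsilonIncreases_univ (j : σ) (b : σ → K) (hbj : b j = 0) (s : CState σ K)
    (hord : (p : ℕ∞) ≤ ordZero s.F) (hinc : EpsilonIncreases p Finset.univ j b s) {t : σ}
    (ht : t ∉ s.exc ∨ b t = 0) (hpd : pderiv t (initialForm s.F) ≠ 0) : t = j := by
  by_contra htj
  exact not_epsilonIncreases_univ_of_pderiv_ne_zero p j b hbj s hord htj ht hpd hinc

/-- **At an exceptional chart, an increase of `ε` forces `V(F_{p,Z},E,m_S) = 0`, i.e. `ω(x) = ε(x)`**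
([CP19, Thm. 3.6 (1)] "`ε(y) = ε(x) = ω(x)`" for `𝒴 = {x}`, chart `u = u_{j₁}` with `j₁ ∈ J_E`).
[cite: CossartPiltant2019, Thm. 3.6 (1) (p. 35)] -/
theorem omega_eq_epsilon_of_epsilonIncreases_univ_of_mem_exc (j : σ) (b : σ → K) (hbj : b j = 0)
    (s : CState σ K) (hord : (p : ℕ∞) ≤ ordZero s.F) (hinc : EpsilonIncreases p Finset.univ j b s)
    (hj : j ∈ s.exc) : s.omega = s.epsilon := by
  refine omega_eq_of_not_vNonzero s ?_
  rintro ⟨t, htE, hpd⟩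
  have h := eq_chart_of_epsilonIncreases_univ p j b hbj s hord hinc (Or.inl htE) hpd
  exact htE (h ▸ hj)

/-- **If the chart variable is not a `V`-witness, an increase of `ε` forces `ω(x) = ε(x)`.**
[cite: CossartPiltant2019, Thm. 3.6 (1) (p. 35)] -/
theorem omega_eq_epsilon_of_epsilonIncreases_univ_of_pderiv_eq_zero (j : σ) (b : σ → K)
    (hbj : b j = 0) (s : CState σ K) (hord : (p : ℕ∞) ≤ ordZero s.F)
    (hinc : EpsilonIncreases p Finset.univ j b s) (hj : pderiv j (initialForm s.F) = 0) :
    s.omega = s.epsilon := by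
  refine omega_eq_of_not_vNonzero s ?_
  rintro ⟨t, htE, hpd⟩
  have h := eq_chart_of_epsilonIncreases_univ p j b hbj s hord hinc (Or.inl htE) hpd
  exact hpd (h ▸ hj)

/-- **The atlas predicate `EpsilonIncreaseForcesFirstKindAt p univ j b s` HOLDS at every exceptional
chart** (`j ∈ exc`): [CP19, Thm. 3.6 (1)] read at one step of the blow-up of the closed point, proved
in the model for these charts. [cite: CossartPiltant2019, Thm. 3.6 (1) (p. 35)] -/
theorem epsilonIncreaseForcesFirstKindAt_univ_of_mem_exc (j : σ) (b : σ → K) (s : CState σ K)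
    (hj : j ∈ s.exc) : EpsilonIncreaseForcesFirstKindAt p Finset.univ j b s := by
  intro _ hbj _ hperm _ _ _ hinc
  exact ⟨epsilonAlong_univ s, omega_eq_epsilon_of_epsilonIncreases_univ_of_mem_exc p j b hbj s
    (le_ordZero_of_isPermissibleCentre_univ' hperm) hinc hj⟩

/-- **The atlas predicate `EpsilonIncreaseForcesFirstKindAt p univ j b s` HOLDS whenever the chart
variable is not a `V`-witness** (`∂F_{p,Z}/∂U_j = 0`). [cite: CossartPiltant2019, Thm. 3.6 (1) (p. 35)] -/
theorem epsilonIncreaseForcesFirstKindAt_univ_of_pderiv_eq_zero (j : σ) (b : σ → K)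
    (s : CState σ K) (hj : pderiv j (initialForm s.F) = 0) :
    EpsilonIncreaseForcesFirstKindAt p Finset.univ j b s := by
  intro _ hbj _ hperm _ _ _ hinc
  exact ⟨epsilonAlong_univ s, omega_eq_epsilon_of_epsilonIncreases_univ_of_pderiv_eq_zero p j b hbj s
    (le_ordZero_of_isPermissibleCentre_univ' hperm) hinc hj⟩

/-- **Necessary conditions for an increase of `ε` under the blow-up of the closed point**, for a
clean `p`-fold state: `p ∣ ord₀ F`; every variable `i ≠ j` which is non-exceptional or exceptional
through `x'` occurs in `F_{p,Z}` with exponents `≡ 0 (mod p)` only; and some exceptional variable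
`i ≠ j` NOT through `x'` (`b_i ≠ 0`) carries an initial exponent prime to `p` ([CP19, Thm. 3.6 (1)]
for `𝒴 = {x}`, up to the chart variable; Hauser–Perlega's lost component).
[cite: CossartPiltant2019, Thm. 3.6 (1) (p. 35)]
[cite: HauserPerlega2019PRIMS, §3 Theorem (2), (7) and Comment (d)] -/
theorem necessary_of_epsilonIncreases_univ (j : σ) (b : σ → K) (hbj : b j = 0) (s : CState σ K)
    (hclean : deletePthPowers p s.F = s.F) (hord : (p : ℕ∞) ≤ ordZero s.F)
    (hinc : EpsilonIncreases p Finset.univ j b s) :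
    ∃ o : ℕ, ordZero s.F = o ∧ p ∣ o ∧
      (∀ i, i ≠ j → (i ∉ s.exc ∨ b i = 0) → ∀ d ∈ s.F.support, d.degree = o → p ∣ d i) ∧
      (∃ i, i ≠ j ∧ b i ≠ 0 ∧ i ∈ s.exc ∧ ∃ d ∈ s.F.support, d.degree = o ∧ ¬ p ∣ d i) := by
  have hF : s.F ≠ 0 := F_ne_zero_of_epsilonIncreases' hinc
  obtain ⟨o, ho⟩ := PointBlowup.exists_ordZero_eq' hF
  have hpo : p ≤ o := by rw [ho] at hord; exact_mod_cast hord
  unfold EpsilonIncreases at hinc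
  rw [epsilon_step_univ] at hinc
  exact ⟨o, ho, PointBlowup.necessary_of_epsilonIncreases p j b hbj s.toState s.exc hclean ho hpo hinc⟩

end Univ

end CState

end CentreBlowup

end Literature.AlgebraicGeometry.Resolution
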